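import Mathlib.Algebra.Order.Chebyshev
import Mathlib.Order.Partition.Finpartition
import Mathlib.Data.Real.Basic
import HarnessLib

/-!
# Cauchy–Schwarz along a partition: `(1/n) e_1([n])² ≤ Σ_k e_1(S_k)²` (Brändén–Huh 2020, §4.3 Lemma 4.12)

Layer `Literature/Combinatorics/LorentzianPolynomials`, namespace `Literature.Combinatorics.LorentzianPolynomials`;
lane `lit-hodgefound` (Track 2 foundations library), seat p16, generation 27 (row g27-#22). The inequality through which
Brändén–Huh bound the Hessian of the Potts-model / independence polynomials (proof of Thm. 4.10: "The conclusion now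
follows from Lemma 4.12"), in two forms: for a `Finpartition` of a finite set, and for the fibres of a map (the parallel
classes of a matroid being the intended instance). Mathlib only: `sq_sum_le_card_mul_sum_sq` (Cauchy–Schwarz with the
all-ones vector) and `Finpartition`.

## Source (verbatim) — P. Brändén, J. Huh, *Lorentzian polynomials* [BrandenHuh2019] (held `paper:arxiv-1902.03719`)

§4.3: "For a nonnegative integer `k` and a subset `S ⊆ [n]`, we define a degree `k` homogeneous polynomial `e^k_S(w)` by
the equation `Σ_{k=0}^n e^k_S(w) = Σ_{A ⊆ S} w^A`. In other words, `e^k_S(w)` is the `k`-th elementary symmetric polynomial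
in the variables `{w_i}_{i ∈ S}`. **Lemma 4.12.** If `S_1 ⊔ … ⊔ S_m` is a partition of `[n]` into `m` nonempty parts, then
`(1/n) e^1_{[n]}(w)^2 ≤ e^1_{S_1}(w)^2 + ⋯ + e^1_{S_m}(w)^2` for all `w ∈ ℝ^n`. *Proof.* Since `m ≤ n`, it is enough to prove
the statement when `m = n`. In this case, we have `(w_1 + ⋯ + w_n)^2 ≤ n (w_1^2 + ⋯ + w_n^2)`, by the Cauchy–Schwarz
inequality for the vectors `(1, …, 1)` and `(w_1, …, w_n)` in `ℝ^n`."

## What is here (`e^1_S(w) = Σ_{i ∈ S} w_i`)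

* `sq_sum_le_card_parts_mul_sum_sq` — the sharper intermediate form `e^1_s(w)² ≤ m · Σ_k e^1_{S_k}(w)²` for a
  `Finpartition` of a finite set `s` with `m` parts (Cauchy–Schwarz over the parts);
* **`sq_sum_le_card_mul_sum_parts_sq`** — Lemma 4.12 as printed: `e^1_s(w)² ≤ #s · Σ_k e^1_{S_k}(w)²` (as `m ≤ #s`), and
  the division form `sq_sum_div_card_le_sum_parts_sq` (`(1/n) e^1(w)² ≤ Σ_k e^1_{S_k}(w)²`);
* the same for the partition of a finite type into the fibres of a map `p : σ → κ` (`sq_sum_le_card_mul_sum_fiber_sq`,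
  `sq_sum_le_card_image_mul_sum_fiber_sq`).

Theorems only (no definition, no named fact; net debt 0).

## References

* [BrandenHuh2019] P. Brändén, J. Huh, *Lorentzian polynomials*, Ann. of Math. (2) 192 (2020) 821–891, arXiv:1902.03719 —
  §4.3 Lemma 4.12.
-/

open Finset

namespace Literature.Combinatorics.LorentzianPolynomials

/-! ## §1 Partitions of a finite set -/

section Finpartition

variable {α : Type*} [DecidableEq α]

/-- `e^1_s(w) = Σ_k e^1_{S_k}(w)` for a partition `s = S_1 ⊔ ⋯ ⊔ S_m`. [cite: BrandenHuh2019, §4.3 Lemma 4.12] -/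
theorem sum_eq_sum_parts_sum {s : Finset α} (P : Finpartition s) (w : α → ℝ) :
    ∑ i ∈ s, w i = ∑ S ∈ P.parts, ∑ i ∈ S, w i := by
  conv_lhs => rw [← P.biUnion_parts]
  rw [Finset.sum_biUnion P.disjoint]
  rfl

/-- **Cauchy–Schwarz over the parts**: `e^1_s(w)² ≤ m · Σ_{k=1}^m e^1_{S_k}(w)²` for a partition of `s` into `m` parts
("the Cauchy–Schwarz inequality for the vectors `(1, …, 1)` and [`(e^1_{S_1}(w), …, e^1_{S_m}(w))`]").
[cite: BrandenHuh2019, §4.3 Lemma 4.12 (proof)] -/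
theorem sq_sum_le_card_parts_mul_sum_sq {s : Finset α} (P : Finpartition s) (w : α → ℝ) :
    (∑ i ∈ s, w i) ^ 2 ≤ P.parts.card * ∑ S ∈ P.parts, (∑ i ∈ S, w i) ^ 2 := by
  rw [sum_eq_sum_parts_sum P w]
  exact sq_sum_le_card_mul_sum_sq

/-- **Brändén–Huh Lemma 4.12**: if `S_1 ⊔ … ⊔ S_m` is a partition of the finite set `s` (into nonempty parts, as every
`Finpartition` is), then `e^1_s(w)² ≤ #s · (e^1_{S_1}(w)² + ⋯ + e^1_{S_m}(w)²)` for all real `w` — "Since `m ≤ n`, it is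
enough to prove the statement when `m = n`". [cite: BrandenHuh2019, §4.3 Lemma 4.12] -/
theorem sq_sum_le_card_mul_sum_parts_sq {s : Finset α} (P : Finpartition s) (w : α → ℝ) :
    (∑ i ∈ s, w i) ^ 2 ≤ s.card * ∑ S ∈ P.parts, (∑ i ∈ S, w i) ^ 2 :=
  (sq_sum_le_card_parts_mul_sum_sq P w).trans (mul_le_mul_of_nonneg_right (by exact_mod_cast P.card_parts_le_card)
    (Finset.sum_nonneg fun _ _ ↦ sq_nonneg _))

/-- Lemma 4.12 in the printed form `(1/n) e^1_{[n]}(w)² ≤ e^1_{S_1}(w)² + ⋯ + e^1_{S_m}(w)²` (`n = #s`; for `s = ∅` both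
sides vanish). [cite: BrandenHuh2019, §4.3 Lemma 4.12] -/
theorem sq_sum_div_card_le_sum_parts_sq {s : Finset α} (P : Finpartition s) (w : α → ℝ) :
    (∑ i ∈ s, w i) ^ 2 / s.card ≤ ∑ S ∈ P.parts, (∑ i ∈ S, w i) ^ 2 := by
  rcases Nat.eq_zero_or_pos s.card with h0 | hpos
  · rw [h0, Nat.cast_zero, div_zero]
    exact Finset.sum_nonneg fun _ _ ↦ sq_nonneg _
  · rw [div_le_iff₀ (by exact_mod_cast hpos), mul_comm]
    exact sq_sum_le_card_mul_sum_parts_sq P w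

end Finpartition

/-! ## §2 Partitions of a finite type into the fibres of a map -/

section Fibers

variable {σ κ : Type*} [Fintype σ] [DecidableEq κ]

/-- `e^1(w) = Σ_{c} e^1_{p⁻¹(c)}(w)`: summing over the fibres of `p : σ → κ`. [cite: BrandenHuh2019, §4.3 Lemma 4.12] -/
theorem sum_eq_sum_image_sum_fiber (p : σ → κ) (w : σ → ℝ) :
    ∑ i, w i = ∑ c ∈ univ.image p, ∑ i ∈ univ.filter (fun i ↦ p i = c), w i := by
  rw [Finset.sum_fiberwise_eq_sum_filter]
  exact (Finset.sum_filter_of_ne fun i _ _ ↦ Finset.mem_image_of_mem p (Finset.mem_univ i)).symm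

/-- Cauchy–Schwarz over the fibres: `e^1(w)² ≤ m · Σ_c e^1_{p⁻¹(c)}(w)²` with `m` the number of nonempty fibres.
[cite: BrandenHuh2019, §4.3 Lemma 4.12 (proof)] -/
theorem sq_sum_le_card_image_mul_sum_fiber_sq (p : σ → κ) (w : σ → ℝ) :
    (∑ i, w i) ^ 2 ≤ (univ.image p).card * ∑ c ∈ univ.image p, (∑ i ∈ univ.filter (fun i ↦ p i = c), w i) ^ 2 := by
  rw [sum_eq_sum_image_sum_fiber p w]
  exact sq_sum_le_card_mul_sum_sq

/-- **Lemma 4.12 for the fibres of a map** (e.g. the parallel classes of a matroid): `e^1(w)² ≤ n · Σ_c e^1_{p⁻¹(c)}(w)²`,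
`n = |σ|`, since the number of nonempty fibres is at most `n`. [cite: BrandenHuh2019, §4.3 Lemma 4.12] -/
theorem sq_sum_le_card_mul_sum_fiber_sq (p : σ → κ) (w : σ → ℝ) :
    (∑ i, w i) ^ 2 ≤ Fintype.card σ * ∑ c ∈ univ.image p, (∑ i ∈ univ.filter (fun i ↦ p i = c), w i) ^ 2 :=
  (sq_sum_le_card_image_mul_sum_fiber_sq p w).trans (mul_le_mul_of_nonneg_right
    (by exact_mod_cast (Finset.card_image_le.trans (Finset.card_univ (α := σ)).le))
    (Finset.sum_nonneg fun _ _ ↦ sq_nonneg _))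

omit [Fintype σ] in
/-- The fibre form restricted to a subset `E ⊆ σ` of the variables (as used for the non-loops of a matroid: `w_i`, `i ∈ E`,
partitioned into parallel classes): `(Σ_{i∈E} w_i)² ≤ #E · Σ_c (Σ_{i ∈ E, p i = c} w_i)²`.
[cite: BrandenHuh2019, §4.3 Lemma 4.12 and proof of Thm. 4.10 ("`P_1, …, P_ℓ ⊆ [n] ∖ L` […] the parallel classes")] -/
theorem sq_sum_le_card_mul_sum_fiber_sq_of_subset [DecidableEq σ] (E : Finset σ) (p : σ → κ) (w : σ → ℝ) :
    (∑ i ∈ E, w i) ^ 2 ≤ E.card * ∑ c ∈ E.image p, (∑ i ∈ E.filter (fun i ↦ p i = c), w i) ^ 2 := by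
  have hsum : ∑ i ∈ E, w i = ∑ c ∈ E.image p, ∑ i ∈ E.filter (fun i ↦ p i = c), w i := by
    rw [Finset.sum_fiberwise_eq_sum_filter]
    exact (Finset.sum_filter_of_ne fun i hi _ ↦ Finset.mem_image_of_mem p hi).symm
  rw [hsum]
  exact sq_sum_le_card_mul_sum_sq.trans (mul_le_mul_of_nonneg_right (by exact_mod_cast Finset.card_image_le)
    (Finset.sum_nonneg fun _ _ ↦ sq_nonneg _))

end Fibers

end Literature.Combinatorics.LorentzianPolynomials
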